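import Literature.AlgebraicGeometry.Motives.HodgeLieRigidTimesRankOne
import Literature.AlgebraicGeometry.Motives.HodgeLieTimesGluedBlocks
import HarnessLib

/-!
# `Θ`-rigidity along a summand with one-dimensional Hodge Lie algebra, II: the trace test with a centre of HIGHER RANK
# (Moonen–Zarhin 1999 §3 (3.1), (3.6), (3.8): Goursat over a one-dimensional factor; no resonance against a multi-dimensional centre)

Family `hodge`, layer `Literature/AlgebraicGeometry/Motives`; THEOREMS ONLY (no definition, no named fact).  Written for the cell `pub-hodgecm2`
(COR-CM), seat `b27` gen 50 (count-neutral Mumford–Tate-rank ladder).  Sequel of `Motives/HodgeLieRigidTimesRankOne` (gen 49), whose §3 trace test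
assumes that the centre `𝔷(H₁) = 𝔥(H₁) ∩ End_Hdg(H₁)` lies on ONE line `ℚφ`.  When `H₁` is itself a product — e.g. `H₁ = H¹(T × E')` for a type-IV
threefold `T` and a CM elliptic curve `E'` of another field, `𝔷(H₁) = ℚφ̃ ⊕ ℚχ̃'` — the centre has higher rank and the Lie functional `L` of the
graph dichotomy has one free parameter per central direction.

SETTING (as in the prequel).  `H ≅ H₁ ⊕ H₂` (`ι_i`, `π_i`), `H₁` `Θ`-rigid, `𝔥(H₂) ⊆ ℚ y₀`, the corner `ι₂ y₀ π₂ ∈ 𝔥(H)`.  By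
`hodgeLie_le_or_exists_graph_of_rigid_of_le_span_singleton` a bracket-closed rational `𝔞 ⊆ 𝔥(H)` with a Hodge operator in `𝔞 ⊗ ℂ` is all of
`𝔥(H)` or the graph of a Lie functional `L` on `𝔥(H₁)` (killing `[𝔥(H₁), 𝔥(H₁)]`).

RESULT **`not_exists_theta_mem_span_graph_of_trace_ne_sum`** — THE TRACE TEST WITH A FINITE TRACE-ORTHOGONAL FAMILY.  Let
`φ_1, …, φ_r ∈ End_Hdg(H₁)` span a rational subspace containing `𝔷(H₁)`, with `tr(φ_i φ_j) = 0` for `i ≠ j` and `tr(φ_i²) ≠ 0`.  If for all Hodge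
operators `Θ₁` of `H₁`, `Θ₂` of `H₂` and every rational vector `ν`:  `tr(Θ₂ y₀,ℂ) ≠ tr(y₀²) · Σ_i ν_i tr(Θ₁ φ_i,ℂ)`, then NO graph of a Lie
functional `L` contains a Hodge operator in its complex span (hence, by the prequel's `rigid_of_rigid_of_le_span_singleton_of_forall_not_graph`,
`H` is `Θ`-rigid).  PROOF.  Deligne: `𝔥(H₁) = 𝔷(H₁) ⊕ [𝔥(H₁), 𝔥(H₁)]`; for `x = Σ c_i φ_i + d` one has `L(x) = Σ c_i L(φ_i)` and `tr(x φ_j) = c_j tr(φ_j²)` (the derived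
part is killed by `L` and by every `tr(· φ_j)`, `φ_j` commuting with `𝔥(H₁)`).  Hence the `ℂ`-linear functional
`F(Z) = tr(π₂ Z ι₂ · y₀) − tr(y₀²) Σ_j (L(φ_j)/tr(φ_j²)) tr(π₁ Z ι₁ · φ_j)` vanishes on the graph of `L`, so on its complex span, so at `Θ`:
`tr(Θ₂ y₀) = tr(y₀²) Σ_j ν_j tr(Θ₁ φ_j)` with `ν_j = L(φ_j)/tr(φ_j²) ∈ ℚ` — excluded.
(For `r = 1` this is the prequel's test up to the normalisation `μ = ν tr(φ²)`.)

§2 (appended, gen 50) — THE CORNER COMES FOR FREE.  The corner hypothesis `ι₂ y₀ π₂ ∈ 𝔥(H)` of the prequel is REDUNDANT: apply the graph argument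
to `𝔞 = 𝔥(H)` itself.  With `H₁` `Θ`-rigid and `𝔥(H₂) ⊆ ℚ y₀`, the restriction `r₁ : 𝔥(H) → 𝔥(H₁)` is onto; if the corner is NOT in `𝔥(H)` then
`𝔥(H) ∩ ker r₁ = 0`, so `𝔥(H)` is the graph of a Lie functional `L` and the Hodge operator `Θ_H ∈ 𝔥(H) ⊗ ℂ` (`mem_hodgeLieC_of_forall_piece`) lies in
its complex span.  Hence «no graph resonates» ⟹ **`ι₂ y₀ π₂ ∈ 𝔥(H)` ∧ `dim 𝔥(H) = dim 𝔥(H₁) + dim 𝔥(H₂)` ∧ `H` `Θ`-rigid**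
(`corner_mem_and_finrank_eq_and_rigid_of_forall_not_graph`, and via §1 `corner_mem_and_finrank_eq_and_rigid_of_trace_ne_sum`) — the induction
step for towers `A × E' × E'' × ⋯` of CM curves of distinct fields (`CorCM/MumfordTateRankTypeIVTimesTwoCMCurves`).

## References
* [MoonenZarhin1999LowDim] B. Moonen, Yu. G. Zarhin, *Hodge classes on abelian varieties of low dimension*, Math. Ann. 315 (1999), §3 (3.1), Lemma (3.6),
  Prop. (3.8) [corpus: paper:arxiv-math_9901113 pp. 6–7]. [cite: MoonenZarhin1999LowDim, §3 (3.1), (3.6) and (3.8)]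
* [Deligne1982HodgeCycles] P. Deligne, LNM 900 (1982), I §3.1, Prop. 3.4 and Prop. 3.6. [cite: Deligne1982HodgeCycles, I §3 Prop. 3.6]
* [Hazama1983] F. Hazama, *Algebraic cycles on abelian varieties with many real endomorphisms*, Tôhoku Math. J. 35 (1983), Lemma (3.1) (Goursat).
  [cite: Hazama1983, Lemma (3.1)]
-/

noncomputable section

open scoped TensorProduct BigOperators

namespace Literature.AlgebraicGeometry.Motives

namespace HodgeStructure

universe u

variable {V₁ : Type u} [AddCommGroup V₁] [Module ℚ V₁] [Module.Finite ℚ V₁]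
  {V₂ : Type u} [AddCommGroup V₂] [Module ℚ V₂] [Module.Finite ℚ V₂]
  {V : Type u} [AddCommGroup V] [Module ℚ V] [Module.Finite ℚ V] [HodgeTensorFacts.{u, u}] {n : ℤ}
  {H₁ : HodgeStructure V₁ n} {H₂ : HodgeStructure V₂ n} {H : HodgeStructure V n}
  (ι₁ : Hom H₁ H) (π₁ : Hom H H₁) (ι₂ : Hom H₂ H) (π₂ : Hom H H₂)
  (hπι₁ : ∀ v, π₁.toLinearMap (ι₁.toLinearMap v) = v) (hπι₂ : ∀ v, π₂.toLinearMap (ι₂.toLinearMap v) = v)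
  (hsum : ∀ v, ι₁.toLinearMap (π₁.toLinearMap v) + ι₂.toLinearMap (π₂.toLinearMap v) = v) {y₀ : Module.End ℚ V₂}

omit [Module.Finite ℚ V] [HodgeTensorFacts.{u, u}] in
/-- Base change of a rational multiple: `(c • T)_ℂ = c • T_ℂ`. [folklore] -/
private theorem baseChange_ratCast_smul_rkf (c : ℚ) (T : Module.End ℚ V) :
    (c • T).baseChange ℂ = (c : ℂ) • T.baseChange ℂ := by
  refine TensorProduct.AlgebraTensorModule.ext fun z v => ?_
  rw [LinearMap.baseChange_tmul, LinearMap.smul_apply, LinearMap.smul_apply, LinearMap.baseChange_tmul,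
    TensorProduct.smul_tmul', ← TensorProduct.smul_tmul, Rat.smul_def, smul_eq_mul]

omit [Module.Finite ℚ V₁] [Module.Finite ℚ V₂] [Module.Finite ℚ V] [HodgeTensorFacts.{u, u}] in
include hπι₁ hπι₂ hsum in
/-- `π₂ ι₁ = 0` for a bicone (`ι₂` is injective and `ι₂ π₂ ι₁ = ι₁ − ι₁ π₁ ι₁ = 0`). [folklore] -/
private theorem proj₂_incl₁_eq_zero_rkf : π₂.toLinearMap ∘ₗ ι₁.toLinearMap = 0 := by
  refine LinearMap.ext fun v => ?_
  have h := hsum (ι₁.toLinearMap v)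
  rw [hπι₁, add_eq_left] at h
  have h' := congrArg π₂.toLinearMap h
  rw [hπι₂, map_zero] at h'
  exact h'

omit [Module.Finite ℚ V] in
include hπι₁ hπι₂ hsum in
/-- **No Lie functional resonates against a trace-orthogonal central family — the trace test with a centre of any rank.**  `H ≅ H₁ ⊕ H₂`
(`ι_i`, `π_i`), `ψ₁` a polarization of `H₁`, `y₀ ∈ End V₂`, and `φ : ι → End_Hdg(H₁)` a finite family with `𝔥(H₁) ∩ End_Hdg(H₁) ⊆ span_ℚ(φ)`,
`tr(φ_i φ_j) = 0` (`i ≠ j`), `tr(φ_i²) ≠ 0`.  If for all Hodge operators `Θ₁` of `H₁`, `Θ₂` of `H₂` and every `ν : ι → ℚ`: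
`tr(Θ₂ y₀,ℂ) ≠ tr(y₀²) · Σ_i ν_i · tr(Θ₁ φ_i,ℂ)`, then for every `ℚ`-linear functional `L` on `End V₁` killing the commutators of `𝔥(H₁)` the complex
span of the graph `{ι₁ x π₁ + L(x)·ι₂ y₀ π₂ : x ∈ 𝔥(H₁)}` contains NO Hodge operator of `H` — the hypothesis of
`rigid_of_rigid_of_le_span_singleton_of_forall_not_graph`, so that `H` is `Θ`-rigid whenever `H₁` is, `𝔥(H₂) ⊆ ℚ y₀` and `ι₂ y₀ π₂ ∈ 𝔥(H)`.
(`𝔥(H₁) = 𝔷(H₁) ⊕ [𝔥(H₁), 𝔥(H₁)]`; the functional `Z ↦ tr(π₂ Z ι₂ · y₀) − tr(y₀²) Σ_j (L(φ_j)/tr(φ_j²)) tr(π₁ Z ι₁ · φ_j)` vanishes on the graph of `L`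
and reads `tr(Θ₂ y₀) − tr(y₀²) Σ_j ν_j tr(Θ₁ φ_j)` at a Hodge operator.) [cite: MoonenZarhin1999LowDim, §3 (3.1), (3.6) and (3.8)]
[cite: Deligne1982HodgeCycles, I §3 Prop. 3.6] -/
theorem not_exists_theta_mem_span_graph_of_trace_ne_sum (ψ₁ : H₁.Polarization) {ι : Type*} [Fintype ι]
    {φ : ι → Module.End ℚ V₁} (hφE : ∀ i, φ i ∈ H₁.endAlg)
    (hcen : H₁.hodgeLie ⊓ Subalgebra.toSubmodule H₁.endAlg ≤ Submodule.span ℚ (Set.range φ))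
    (horth : ∀ i j, i ≠ j → LinearMap.trace ℚ V₁ (φ i * φ j) = 0) (htr : ∀ i, LinearMap.trace ℚ V₁ (φ i * φ i) ≠ 0)
    (hNR : ∀ Θ₁ : Module.End ℂ (ℂ ⊗[ℚ] V₁), (∀ p, ∀ x ∈ H₁.piece p (n - p), Θ₁ x = ((2 * p - n : ℤ) : ℂ) • x) →
      ∀ Θ₂ : Module.End ℂ (ℂ ⊗[ℚ] V₂), (∀ p, ∀ x ∈ H₂.piece p (n - p), Θ₂ x = ((2 * p - n : ℤ) : ℂ) • x) →
      ∀ ν : ι → ℚ, LinearMap.trace ℂ _ (Θ₂ * y₀.baseChange ℂ) ≠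
        ((LinearMap.trace ℚ V₂ (y₀ * y₀) : ℚ) : ℂ) * ∑ i, (ν i : ℂ) * LinearMap.trace ℂ _ (Θ₁ * (φ i).baseChange ℂ))
    {L : Module.End ℚ V₁ →ₗ[ℚ] ℚ} (hL : ∀ A ∈ H₁.hodgeLie, ∀ B ∈ H₁.hodgeLie, L (A * B - B * A) = 0) :
    ¬ ∃ Θ ∈ Submodule.span ℂ ((fun X : Module.End ℚ V => X.baseChange ℂ) ''
        {Z | ∃ x ∈ H₁.hodgeLie, Z = ι₁.toLinearMap ∘ₗ x ∘ₗ π₁.toLinearMap + L x • (ι₂.toLinearMap ∘ₗ y₀ ∘ₗ π₂.toLinearMap)}),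
      ∀ p, ∀ v ∈ H.piece p (n - p), Θ v = ((2 * p - n : ℤ) : ℂ) • v := by
  classical
  rintro ⟨Θ, hΘmem, hΘ⟩
  -- complexified block maps and the Hodge operators of the factors
  have hπιc₁ : π₁.toLinearMap ∘ₗ ι₁.toLinearMap = LinearMap.id := LinearMap.ext hπι₁
  have hπιc₂ : π₂.toLinearMap ∘ₗ ι₂.toLinearMap = LinearMap.id := LinearMap.ext hπι₂
  have h21 : π₂.toLinearMap ∘ₗ ι₁.toLinearMap = 0 := proj₂_incl₁_eq_zero_rkf ι₁ π₁ ι₂ π₂ hπι₁ hπι₂ hsum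
  set Θ₁ := π₁.toLinearMap.baseChange ℂ ∘ₗ Θ ∘ₗ ι₁.toLinearMap.baseChange ℂ with hΘ₁def
  set Θ₂ := π₂.toLinearMap.baseChange ℂ ∘ₗ Θ ∘ₗ ι₂.toLinearMap.baseChange ℂ with hΘ₂def
  have hΘ₁ : ∀ p, ∀ x ∈ H₁.piece p (n - p), Θ₁ x = ((2 * p - n : ℤ) : ℂ) • x := by
    intro p x hx
    have hιx : ι₁.toLinearMap.baseChange ℂ x ∈ H.piece p (n - p) := ι₁.map_piece_le p (n - p) ⟨x, hx, rfl⟩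
    rw [hΘ₁def, LinearMap.comp_apply, LinearMap.comp_apply, hΘ p _ hιx, map_smul, ← LinearMap.comp_apply,
      ← LinearMap.baseChange_comp, hπιc₁, LinearMap.baseChange_id, LinearMap.id_apply]
  have hΘ₂ : ∀ p, ∀ x ∈ H₂.piece p (n - p), Θ₂ x = ((2 * p - n : ℤ) : ℂ) • x := by
    intro p x hx
    have hιx : ι₂.toLinearMap.baseChange ℂ x ∈ H.piece p (n - p) := ι₂.map_piece_le p (n - p) ⟨x, hx, rfl⟩
    rw [hΘ₂def, LinearMap.comp_apply, LinearMap.comp_apply, hΘ p _ hιx, map_smul, ← LinearMap.comp_apply,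
      ← LinearMap.baseChange_comp, hπιc₂, LinearMap.baseChange_id, LinearMap.id_apply]
  -- the test functional
  let blk₁ : Module.End ℂ (ℂ ⊗[ℚ] V) →ₗ[ℂ] Module.End ℂ (ℂ ⊗[ℚ] V₁) :=
    (LinearMap.llcomp ℂ _ _ _ (π₁.toLinearMap.baseChange ℂ)).comp (LinearMap.lcomp ℂ _ (ι₁.toLinearMap.baseChange ℂ))
  let blk₂ : Module.End ℂ (ℂ ⊗[ℚ] V) →ₗ[ℂ] Module.End ℂ (ℂ ⊗[ℚ] V₂) :=
    (LinearMap.llcomp ℂ _ _ _ (π₂.toLinearMap.baseChange ℂ)).comp (LinearMap.lcomp ℂ _ (ι₂.toLinearMap.baseChange ℂ))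
  let t₁ : ι → (Module.End ℂ (ℂ ⊗[ℚ] V) →ₗ[ℂ] ℂ) := fun i =>
    LinearMap.trace ℂ _ ∘ₗ LinearMap.mulRight ℂ ((φ i).baseChange ℂ) ∘ₗ blk₁
  let t₂ : Module.End ℂ (ℂ ⊗[ℚ] V) →ₗ[ℂ] ℂ := LinearMap.trace ℂ _ ∘ₗ LinearMap.mulRight ℂ (y₀.baseChange ℂ) ∘ₗ blk₂
  have ht₁ : ∀ i Z, t₁ i Z =
      LinearMap.trace ℂ _ ((π₁.toLinearMap.baseChange ℂ ∘ₗ Z ∘ₗ ι₁.toLinearMap.baseChange ℂ) * (φ i).baseChange ℂ) := fun i Z => rfl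
  have ht₂ : ∀ Z, t₂ Z = LinearMap.trace ℂ _ ((π₂.toLinearMap.baseChange ℂ ∘ₗ Z ∘ₗ ι₂.toLinearMap.baseChange ℂ) * y₀.baseChange ℂ) :=
    fun Z => rfl
  set ν : ι → ℚ := fun i => L (φ i) / LinearMap.trace ℚ V₁ (φ i * φ i) with hν
  let F : Module.End ℂ (ℂ ⊗[ℚ] V) →ₗ[ℂ] ℂ :=
    t₂ - ((LinearMap.trace ℚ V₂ (y₀ * y₀) : ℚ) : ℂ) • ∑ i, (ν i : ℂ) • t₁ i
  have hF : ∀ Z, F Z = t₂ Z - ((LinearMap.trace ℚ V₂ (y₀ * y₀) : ℚ) : ℂ) * ∑ i, (ν i : ℂ) * t₁ i Z := by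
    intro Z
    simp only [F, LinearMap.sub_apply, LinearMap.smul_apply, LinearMap.coe_sum, Finset.sum_apply, smul_eq_mul]
  -- `L` and `tr(· φ_j)` on `𝔥(H₁) = 𝔷 ⊕ [𝔥, 𝔥]`
  have hLd : ∀ d ∈ Submodule.span ℚ {B | ∃ X ∈ H₁.hodgeLie, ∃ Y ∈ H₁.hodgeLie, X * Y - Y * X = B}, L d = 0 := by
    intro d hd
    have hle : Submodule.span ℚ {B | ∃ X ∈ H₁.hodgeLie, ∃ Y ∈ H₁.hodgeLie, X * Y - Y * X = B} ≤ LinearMap.ker L :=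
      Submodule.span_le.2 (by rintro _ ⟨X, hX, Y, hY, rfl⟩; exact hL X hX Y hY)
    exact hle hd
  have htrd : ∀ j, ∀ d ∈ Submodule.span ℚ {B | ∃ X ∈ H₁.hodgeLie, ∃ Y ∈ H₁.hodgeLie, X * Y - Y * X = B},
      LinearMap.trace ℚ V₁ (d * φ j) = 0 := by
    intro j d hd
    have hle : Submodule.span ℚ {B | ∃ X ∈ H₁.hodgeLie, ∃ Y ∈ H₁.hodgeLie, X * Y - Y * X = B} ≤
        LinearMap.ker (LinearMap.trace ℚ V₁ ∘ₗ LinearMap.mulRight ℚ (φ j)) :=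
      Submodule.span_le.2 (by
        rintro _ ⟨X, hX, Y, hY, rfl⟩
        have hYφ : Y * φ j = φ j * Y := commute_of_mem_hodgeLie H₁ hY ⟨φ j, hφE j⟩
        change LinearMap.trace ℚ V₁ ((X * Y - Y * X) * φ j) = 0
        rw [sub_mul, map_sub, mul_assoc, mul_assoc, hYφ, ← mul_assoc X (φ j) Y, LinearMap.trace_mul_comm ℚ (X * φ j) Y, sub_self])
    exact hle hd
  have hdec : ∀ x ∈ H₁.hodgeLie, ∃ c : ι → ℚ, L x = ∑ i, c i * L (φ i) ∧
      ∀ j, LinearMap.trace ℚ V₁ (x * φ j) = c j * LinearMap.trace ℚ V₁ (φ j * φ j) := by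
    intro x hx
    rw [← AnyWeight.hodgeLie_center_sup_derived_eq H₁ ψ₁] at hx
    obtain ⟨z, hz, d, hd, rfl⟩ := Submodule.mem_sup.1 hx
    obtain ⟨c, hc⟩ := (Submodule.mem_span_range_iff_exists_fun ℚ).1 (hcen hz)
    refine ⟨c, ?_, fun j => ?_⟩
    · rw [map_add, hLd d hd, add_zero, ← hc, map_sum]
      exact Finset.sum_congr rfl fun i _ => by rw [map_smul, smul_eq_mul]
    · rw [add_mul, map_add, htrd j d hd, add_zero, ← hc, Finset.sum_mul, map_sum]
      rw [Finset.sum_eq_single j (fun i _ hij => by rw [smul_mul_assoc, map_smul, horth i j hij, smul_zero])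
        (fun h => absurd (Finset.mem_univ j) h), smul_mul_assoc, map_smul, smul_eq_mul]
  -- `F` vanishes on the graph generators
  have hgen : ∀ x ∈ H₁.hodgeLie,
      F ((ι₁.toLinearMap ∘ₗ x ∘ₗ π₁.toLinearMap + L x • (ι₂.toLinearMap ∘ₗ y₀ ∘ₗ π₂.toLinearMap)).baseChange ℂ) = 0 := by
    intro x hx
    obtain ⟨c, hLx, htrx⟩ := hdec x hx
    have hb₁ : π₁.toLinearMap.baseChange ℂ ∘ₗ (ι₁.toLinearMap ∘ₗ x ∘ₗ π₁.toLinearMap + L x • (ι₂.toLinearMap ∘ₗ y₀ ∘ₗ π₂.toLinearMap)).baseChange ℂ ∘ₗ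
        ι₁.toLinearMap.baseChange ℂ = x.baseChange ℂ := by
      rw [← LinearMap.baseChange_comp, ← LinearMap.baseChange_comp]
      congr 1
      rw [LinearMap.add_comp, LinearMap.comp_add, LinearMap.smul_comp, LinearMap.comp_smul]
      have e1 : π₁.toLinearMap ∘ₗ (ι₁.toLinearMap ∘ₗ x ∘ₗ π₁.toLinearMap) ∘ₗ ι₁.toLinearMap = x :=
        LinearMap.ext fun v => by simp only [LinearMap.comp_apply, hπι₁]
      have e2 : π₁.toLinearMap ∘ₗ (ι₂.toLinearMap ∘ₗ y₀ ∘ₗ π₂.toLinearMap) ∘ₗ ι₁.toLinearMap = 0 :=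
        LinearMap.ext fun v => by
          have h := LinearMap.congr_fun h21 v
          simp only [LinearMap.comp_apply, LinearMap.zero_apply] at h
          simp only [LinearMap.comp_apply, h, map_zero, LinearMap.zero_apply]
      rw [e1, e2, smul_zero, add_zero]
    have hb₂ : π₂.toLinearMap.baseChange ℂ ∘ₗ (ι₁.toLinearMap ∘ₗ x ∘ₗ π₁.toLinearMap + L x • (ι₂.toLinearMap ∘ₗ y₀ ∘ₗ π₂.toLinearMap)).baseChange ℂ ∘ₗ
        ι₂.toLinearMap.baseChange ℂ = ((L x : ℚ) : ℂ) • y₀.baseChange ℂ := by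
      rw [← LinearMap.baseChange_comp, ← LinearMap.baseChange_comp, ← baseChange_ratCast_smul_rkf]
      congr 1
      rw [LinearMap.add_comp, LinearMap.comp_add, LinearMap.smul_comp, LinearMap.comp_smul]
      have e1 : π₂.toLinearMap ∘ₗ (ι₁.toLinearMap ∘ₗ x ∘ₗ π₁.toLinearMap) ∘ₗ ι₂.toLinearMap = 0 :=
        LinearMap.ext fun v => by
          have h := LinearMap.congr_fun h21 (x (π₁.toLinearMap (ι₂.toLinearMap v)))
          simp only [LinearMap.comp_apply, LinearMap.zero_apply] at h
          simp only [LinearMap.comp_apply, h, LinearMap.zero_apply]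
      have e2 : π₂.toLinearMap ∘ₗ (ι₂.toLinearMap ∘ₗ y₀ ∘ₗ π₂.toLinearMap) ∘ₗ ι₂.toLinearMap = y₀ :=
        LinearMap.ext fun v => by simp only [LinearMap.comp_apply, hπι₂]
      rw [e1, e2, zero_add]
    have ht₁x : ∀ i, t₁ i ((ι₁.toLinearMap ∘ₗ x ∘ₗ π₁.toLinearMap + L x • (ι₂.toLinearMap ∘ₗ y₀ ∘ₗ π₂.toLinearMap)).baseChange ℂ) =
        ((c i * LinearMap.trace ℚ V₁ (φ i * φ i) : ℚ) : ℂ) := by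
      intro i
      rw [ht₁, hb₁, ← LinearMap.baseChange_mul, LinearMap.trace_baseChange, htrx i, eq_ratCast]
    have ht₂x : t₂ ((ι₁.toLinearMap ∘ₗ x ∘ₗ π₁.toLinearMap + L x • (ι₂.toLinearMap ∘ₗ y₀ ∘ₗ π₂.toLinearMap)).baseChange ℂ) =
        ((L x : ℚ) : ℂ) * ((LinearMap.trace ℚ V₂ (y₀ * y₀) : ℚ) : ℂ) := by
      rw [ht₂, hb₂, smul_mul_assoc, map_smul, ← LinearMap.baseChange_mul, LinearMap.trace_baseChange, smul_eq_mul, eq_ratCast]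
    have hkey : ∀ i, (ν i : ℂ) * ((c i * LinearMap.trace ℚ V₁ (φ i * φ i) : ℚ) : ℂ) = ((c i * L (φ i) : ℚ) : ℂ) := by
      intro i
      rw [← Rat.cast_mul]
      congr 1
      rw [hν]
      field_simp [htr i]
    rw [hF, ht₂x, Finset.sum_congr rfl fun i _ => by rw [ht₁x i, hkey i], hLx]
    rw [← Rat.cast_sum, Rat.cast_sum]
    push_cast
    rw [Finset.mul_sum, Finset.sum_mul, ← Finset.sum_sub_distrib]
    exact Finset.sum_eq_zero fun i _ => by ring
  -- hence on the complex span of the graph, in particular at `Θ`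
  have hFΘ : F Θ = 0 := by
    have hle : Submodule.span ℂ ((fun X : Module.End ℚ V => X.baseChange ℂ) ''
        {Z | ∃ x ∈ H₁.hodgeLie, Z = ι₁.toLinearMap ∘ₗ x ∘ₗ π₁.toLinearMap + L x • (ι₂.toLinearMap ∘ₗ y₀ ∘ₗ π₂.toLinearMap)}) ≤
        LinearMap.ker F :=
      Submodule.span_le.2 (by
        rintro _ ⟨Z, ⟨x, hx, rfl⟩, rfl⟩
        exact hgen x hx)
    exact hle hΘmem
  -- but `F Θ = tr(Θ₂ y₀) − tr(y₀²) Σ ν_i tr(Θ₁ φ_i) ≠ 0`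
  refine hNR Θ₁ hΘ₁ Θ₂ hΘ₂ ν ?_
  have h := hFΘ
  rw [hF, ht₂, ← hΘ₂def] at h
  have h' : ∀ i, t₁ i Θ = LinearMap.trace ℂ _ (Θ₁ * (φ i).baseChange ℂ) := fun i => by rw [ht₁, ← hΘ₁def]
  rw [Finset.sum_congr rfl fun i _ => by rw [h' i]] at h
  exact sub_eq_zero.1 h

/-! ## §2 The corner comes for free: no resonance ⟹ corner, splitting and rigidity -/

section Splitting

variable
  (hrig₁ : ∀ 𝔞 : Submodule ℚ (Module.End ℚ V₁), 𝔞 ≤ H₁.hodgeLie →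
      (∀ X ∈ 𝔞, ∀ Y ∈ 𝔞, X * Y - Y * X ∈ 𝔞) →
      (∃ Θ ∈ Submodule.span ℂ ((fun X : Module.End ℚ V₁ => X.baseChange ℂ) '' (𝔞 : Set (Module.End ℚ V₁))),
        ∀ p, ∀ x ∈ H₁.piece p (n - p), Θ x = ((2 * p - n : ℤ) : ℂ) • x) → H₁.hodgeLie ≤ 𝔞)
  (hy₀ : H₂.hodgeLie ≤ ℚ ∙ y₀)

include hπι₁ hπι₂ hsum hrig₁ hy₀ in
/-- **No graph resonates ⟹ the corner `ι₂ y₀ π₂` lies in `𝔥(H)`, `dim 𝔥(H) = dim 𝔥(H₁) + dim 𝔥(H₂)`, and `H` is `Θ`-rigid.**  `H ≅ H₁ ⊕ H₂`, `H₁`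
`Θ`-rigid, `𝔥(H₂) ⊆ ℚ y₀`; hypothesis: for every `ℚ`-linear functional `L` on `End V₁` killing the commutators of `𝔥(H₁)`, the complex span of the graph
`{ι₁ x π₁ + L(x)·ι₂ y₀ π₂ : x ∈ 𝔥(H₁)}` contains no Hodge operator of `H`.  (If the corner were not in `𝔥(H)`, `𝔥(H)` itself would be such a graph —
`r₁` is onto `𝔥(H₁)` by rigidity and injective on `𝔥(H)` — containing `Θ_H` in its complex span.  With the corner, `𝔥(H)` contains the first corners of
its elements, so the block map is an isomorphism `𝔥(H₁) × 𝔥(H₂) ≅ 𝔥(H)`; rigidity is the prequel's `rigid_of_rigid_of_le_span_singleton_of_forall_not_graph`.)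
[cite: MoonenZarhin1999LowDim, §3 (3.1), (3.6) and (3.8)] [cite: Deligne1982HodgeCycles, I §3 Prop. 3.4 and Prop. 3.6] [cite: Hazama1983, Lemma (3.1)] -/
theorem corner_mem_and_finrank_eq_and_rigid_of_forall_not_graph
    (hNR : ∀ L : Module.End ℚ V₁ →ₗ[ℚ] ℚ, (∀ A ∈ H₁.hodgeLie, ∀ B ∈ H₁.hodgeLie, L (A * B - B * A) = 0) →
      ¬ ∃ Θ ∈ Submodule.span ℂ ((fun X : Module.End ℚ V => X.baseChange ℂ) ''
          {Z | ∃ x ∈ H₁.hodgeLie, Z = ι₁.toLinearMap ∘ₗ x ∘ₗ π₁.toLinearMap + L x • (ι₂.toLinearMap ∘ₗ y₀ ∘ₗ π₂.toLinearMap)}),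
        ∀ p, ∀ v ∈ H.piece p (n - p), Θ v = ((2 * p - n : ℤ) : ℂ) • v) :
    ι₂.toLinearMap ∘ₗ y₀ ∘ₗ π₂.toLinearMap ∈ H.hodgeLie ∧
      Module.finrank ℚ H.hodgeLie = Module.finrank ℚ H₁.hodgeLie + Module.finrank ℚ H₂.hodgeLie ∧
      ∀ 𝔞 : Submodule ℚ (Module.End ℚ V), 𝔞 ≤ H.hodgeLie →
        (∀ X ∈ 𝔞, ∀ Y ∈ 𝔞, X * Y - Y * X ∈ 𝔞) →
        (∃ Θ ∈ Submodule.span ℂ ((fun X : Module.End ℚ V => X.baseChange ℂ) '' (𝔞 : Set (Module.End ℚ V))),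
          ∀ p, ∀ x ∈ H.piece p (n - p), Θ x = ((2 * p - n : ℤ) : ℂ) • x) → H.hodgeLie ≤ 𝔞 := by
  classical
  set r := (LinearMap.llcomp ℚ V₁ V V₁ π₁.toLinearMap).comp (LinearMap.lcomp ℚ V ι₁.toLinearMap) with hr
  have hr_apply : ∀ X : Module.End ℚ V, r X = π₁.toLinearMap ∘ₗ X ∘ₗ ι₁.toLinearMap := fun X => rfl
  set c₀ := ι₂.toLinearMap ∘ₗ y₀ ∘ₗ π₂.toLinearMap with hc₀
  -- `r₁` maps `𝔥(H)` onto `𝔥(H₁)` (rigidity of `H₁`)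
  have himg : H.hodgeLie.map r = H₁.hodgeLie := (hodgeLie_eq_map_restrict_of_rigid ι₁ π₁ hπι₁ hrig₁).symm
  -- the second block of an element of `𝔥(H)` is a multiple of `y₀`; zero first block ⟹ a multiple of the corner
  have hr₂ : ∀ z ∈ H.hodgeLie, ∃ q : ℚ, π₂.toLinearMap ∘ₗ z ∘ₗ ι₂.toLinearMap = q • y₀ := fun z hz =>
    Submodule.mem_span_singleton.1 (hy₀ (comp_mem_hodgeLie_of_retract ι₂ π₂ hπι₂ hz)) |>.imp fun q hq => hq.symm
  have hker : ∀ z ∈ H.hodgeLie, π₁.toLinearMap ∘ₗ z ∘ₗ ι₁.toLinearMap = 0 → ∃ q : ℚ, z = q • c₀ := by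
    intro z hz hz0
    obtain ⟨q, hq⟩ := hr₂ z hz
    refine ⟨q, ?_⟩
    have h := eq_sum_blocks_of_mem_hodgeLie ι₁ π₁ ι₂ π₂ hπι₁ hπι₂ hsum hz
    rw [hz0, LinearMap.zero_comp, LinearMap.comp_zero, zero_add, hq, LinearMap.smul_comp, LinearMap.comp_smul] at h
    exact h
  -- (1) the corner lies in `𝔥(H)`
  have hcorner : c₀ ∈ H.hodgeLie := by
    by_contra hc
    have hy₀0 : y₀ ≠ 0 := by
      rintro rfl
      apply hc
      rw [hc₀, LinearMap.zero_comp, LinearMap.comp_zero]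
      exact Submodule.zero_mem _
    have hinj : ∀ a ∈ H.hodgeLie, r a = 0 → a = 0 := by
      intro a ha ha0
      obtain ⟨q, hq⟩ := hker a ha (by rw [← hr_apply]; exact ha0)
      by_cases hq0 : q = 0
      · rw [hq, hq0, zero_smul]
      · exfalso
        apply hc
        have : c₀ = q⁻¹ • a := by rw [hq, smul_smul, inv_mul_cancel₀ hq0, one_smul]
        rw [this]
        exact Submodule.smul_mem _ _ ha
    -- `e : 𝔥(H) ≃ 𝔥(H₁)` along `r`
    have hrange : ∀ a : H.hodgeLie, r a ∈ H₁.hodgeLie := fun a => by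
      rw [← himg]; exact Submodule.mem_map_of_mem a.2
    let e₀ : H.hodgeLie →ₗ[ℚ] H₁.hodgeLie := LinearMap.codRestrict _ (r.domRestrict H.hodgeLie) hrange
    have he₀ : ∀ a : H.hodgeLie, ((e₀ a : H₁.hodgeLie) : Module.End ℚ V₁) = r a := fun a => rfl
    have he₀inj : Function.Injective e₀ := by
      intro a b hab
      apply Subtype.ext
      have h : r (a : Module.End ℚ V) = r b := by
        have := congrArg (fun x : H₁.hodgeLie => (x : Module.End ℚ V₁)) hab
        simpa [he₀] using this
      have h0 : (a : Module.End ℚ V) - b = 0 :=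
        hinj _ (Submodule.sub_mem _ a.2 b.2) (by rw [map_sub, h, sub_self])
      exact sub_eq_zero.1 h0
    have he₀surj : Function.Surjective e₀ := by
      rintro ⟨x, hx⟩
      rw [← himg] at hx
      obtain ⟨a, ha, rfl⟩ := hx
      exact ⟨⟨a, ha⟩, Subtype.ext rfl⟩
    let e : H.hodgeLie ≃ₗ[ℚ] H₁.hodgeLie := LinearEquiv.ofBijective e₀ ⟨he₀inj, he₀surj⟩
    have he : ∀ a : H.hodgeLie, ((e a : H₁.hodgeLie) : Module.End ℚ V₁) = r a := fun a => rfl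
    -- the coefficient of the second block along `y₀`
    let s₂ := (LinearMap.llcomp ℚ V₂ V V₂ π₂.toLinearMap).comp (LinearMap.lcomp ℚ V ι₂.toLinearMap)
    have hs₂_apply : ∀ X : Module.End ℚ V, s₂ X = π₂.toLinearMap ∘ₗ X ∘ₗ ι₂.toLinearMap := fun X => rfl
    have hs₂mem : ∀ a : H.hodgeLie, s₂ a ∈ ℚ ∙ y₀ := fun a => by
      rw [hs₂_apply]; exact hy₀ (comp_mem_hodgeLie_of_retract ι₂ π₂ hπι₂ a.2)
    let coef : H.hodgeLie →ₗ[ℚ] ℚ :=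
      (LinearEquiv.toSpanNonzeroSingleton ℚ (Module.End ℚ V₂) y₀ hy₀0).symm.toLinearMap ∘ₗ
        LinearMap.codRestrict _ (s₂.domRestrict H.hodgeLie) hs₂mem
    have hcoef : ∀ a : H.hodgeLie, coef a • y₀ = π₂.toLinearMap ∘ₗ (a : Module.End ℚ V) ∘ₗ ι₂.toLinearMap := fun a =>
      LinearEquiv.toSpanNonzeroSingleton_symm_apply_smul ℚ (Module.End ℚ V₂) y₀ hy₀0 ⟨_, hs₂mem a⟩
    -- the functional `L`: extend `coef ∘ e⁻¹` from `𝔥(H₁)` to `End V₁`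
    obtain ⟨L, hL⟩ := LinearMap.exists_extend (coef ∘ₗ e.symm.toLinearMap : H₁.hodgeLie →ₗ[ℚ] ℚ)
    have hLr : ∀ a : H.hodgeLie, L (r a) = coef a := fun a => by
      have h := LinearMap.congr_fun hL (e a)
      simp only [LinearMap.comp_apply, Submodule.subtype_apply, LinearEquiv.coe_toLinearMap, LinearEquiv.symm_apply_apply] at h
      rw [← he a]
      exact h
    refine hNR L ?_ ?_
    · -- `L` kills commutators of `𝔥(H₁)`
      intro A hA B hB
      set a := e.symm ⟨A, hA⟩ with ha
      set b := e.symm ⟨B, hB⟩ with hb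
      have hra : r a = A := by rw [← he a, ha, LinearEquiv.apply_symm_apply]
      have hrb : r b = B := by rw [← he b, hb, LinearEquiv.apply_symm_apply]
      have hab : (a : Module.End ℚ V) * (b : Module.End ℚ V) - (b : Module.End ℚ V) * (a : Module.End ℚ V) ∈ H.hodgeLie :=
        commutator_mem_hodgeLie H a.2 b.2
      have hrab : r ((a : Module.End ℚ V) * (b : Module.End ℚ V) - (b : Module.End ℚ V) * (a : Module.End ℚ V)) = A * B - B * A := by
        rw [map_sub, hr_apply, hr_apply, restrict_mul ι₁ π₁ hπι₁ b.2, restrict_mul ι₁ π₁ hπι₁ a.2, ← hr_apply, ← hr_apply, hra, hrb]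
      rw [← hrab, hLr ⟨_, hab⟩]
      have h2 : coef ⟨_, hab⟩ • y₀ = 0 := by
        rw [hcoef ⟨_, hab⟩]
        change π₂.toLinearMap ∘ₗ ((a : Module.End ℚ V) * (b : Module.End ℚ V) - (b : Module.End ℚ V) * (a : Module.End ℚ V)) ∘ₗ
          ι₂.toLinearMap = 0
        rw [LinearMap.sub_comp, LinearMap.comp_sub, restrict_mul ι₂ π₂ hπι₂ b.2, restrict_mul ι₂ π₂ hπι₂ a.2, ← hcoef a, ← hcoef b]
        rw [smul_mul_smul_comm, smul_mul_smul_comm, mul_comm (coef b) (coef a), sub_self]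
      exact (smul_eq_zero.1 h2).resolve_right hy₀0
    · -- `Θ_H` lies in the complex span of the graph `𝔥(H)`
      obtain ⟨Θ, hΘ⟩ := exists_hodgeTheta H
      have hΘ𝔥 : Θ ∈ Submodule.span ℂ ((fun X : Module.End ℚ V => X.baseChange ℂ) '' (H.hodgeLie : Set (Module.End ℚ V))) :=
        H.mem_hodgeLieC_of_forall_piece hΘ
      refine ⟨Θ, Submodule.span_mono (Set.image_mono fun a ha => ?_) hΘ𝔥, hΘ⟩
      have h := eq_sum_blocks_of_mem_hodgeLie ι₁ π₁ ι₂ π₂ hπι₁ hπι₂ hsum ha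
      have h2 : π₂.toLinearMap ∘ₗ a ∘ₗ ι₂.toLinearMap = L (π₁.toLinearMap ∘ₗ a ∘ₗ ι₁.toLinearMap) • y₀ := by
        rw [← hr_apply, hLr ⟨a, ha⟩, hcoef ⟨a, ha⟩]
      rw [h2, LinearMap.smul_comp, LinearMap.comp_smul] at h
      exact ⟨π₁.toLinearMap ∘ₗ a ∘ₗ ι₁.toLinearMap, comp_mem_hodgeLie_of_retract ι₁ π₁ hπι₁ ha, h⟩
  -- (2) first corners, the block isomorphism and the dimension
  have hfirst : ∀ X ∈ H.hodgeLie, ι₁.toLinearMap ∘ₗ (π₁.toLinearMap ∘ₗ X ∘ₗ ι₁.toLinearMap) ∘ₗ π₁.toLinearMap ∈ H.hodgeLie := by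
    intro X hX
    obtain ⟨q, hq⟩ := hr₂ X hX
    have hsplit := eq_sum_blocks_of_mem_hodgeLie ι₁ π₁ ι₂ π₂ hπι₁ hπι₂ hsum hX
    have heq : ι₁.toLinearMap ∘ₗ (π₁.toLinearMap ∘ₗ X ∘ₗ ι₁.toLinearMap) ∘ₗ π₁.toLinearMap = X - q • c₀ := by
      rw [eq_sub_iff_add_eq, hc₀, ← LinearMap.comp_smul, ← LinearMap.smul_comp, ← hq]
      exact hsplit.symm
    rw [heq]
    exact Submodule.sub_mem _ hX (Submodule.smul_mem _ _ hcorner)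
  obtain ⟨Φ, -⟩ := exists_linearEquiv_prod_hodgeLie_of_corner_mem ι₁ π₁ ι₂ π₂ hπι₁ hπι₂ hsum hfirst
  refine ⟨hcorner, by rw [← Φ.finrank_eq, Module.finrank_prod], ?_⟩
  -- (3) rigidity
  exact rigid_of_rigid_of_le_span_singleton_of_forall_not_graph ι₁ π₁ ι₂ π₂ hπι₁ hπι₂ hsum hrig₁ hy₀ hcorner hNR

include hπι₁ hπι₂ hsum hrig₁ hy₀ in
/-- **The trace test ⟹ corner, splitting and rigidity.**  `H ≅ H₁ ⊕ H₂`, `H₁` `Θ`-rigid with a polarization `ψ₁`, `𝔥(H₂) ⊆ ℚ y₀`, and a finite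
family `φ : ι → End_Hdg(H₁)` with `𝔥(H₁) ∩ End_Hdg(H₁) ⊆ span_ℚ(φ)`, `tr(φ_i φ_j) = 0` (`i ≠ j`), `tr(φ_i²) ≠ 0`.  If
`tr(Θ₂ y₀,ℂ) ≠ tr(y₀²) Σ_i ν_i tr(Θ₁ φ_i,ℂ)` for all Hodge operators `Θ₁`, `Θ₂` of `H₁`, `H₂` and all `ν : ι → ℚ`, then `ι₂ y₀ π₂ ∈ 𝔥(H)`,
`dim 𝔥(H) = dim 𝔥(H₁) + dim 𝔥(H₂)` («`Hg(X₁ × X₂) = Hg(X₁) × Hg(X₂)`») and `H` is `Θ`-rigid — so the test can be iterated along a tower of rank-one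
summands. [cite: MoonenZarhin1999LowDim, §3 (3.1), (3.6) and (3.8)] [cite: Deligne1982HodgeCycles, I §3 Prop. 3.4 and Prop. 3.6] -/
theorem corner_mem_and_finrank_eq_and_rigid_of_trace_ne_sum (ψ₁ : H₁.Polarization) {ι : Type*} [Fintype ι]
    {φ : ι → Module.End ℚ V₁} (hφE : ∀ i, φ i ∈ H₁.endAlg)
    (hcen : H₁.hodgeLie ⊓ Subalgebra.toSubmodule H₁.endAlg ≤ Submodule.span ℚ (Set.range φ))
    (horth : ∀ i j, i ≠ j → LinearMap.trace ℚ V₁ (φ i * φ j) = 0) (htr : ∀ i, LinearMap.trace ℚ V₁ (φ i * φ i) ≠ 0)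
    (hNR : ∀ Θ₁ : Module.End ℂ (ℂ ⊗[ℚ] V₁), (∀ p, ∀ x ∈ H₁.piece p (n - p), Θ₁ x = ((2 * p - n : ℤ) : ℂ) • x) →
      ∀ Θ₂ : Module.End ℂ (ℂ ⊗[ℚ] V₂), (∀ p, ∀ x ∈ H₂.piece p (n - p), Θ₂ x = ((2 * p - n : ℤ) : ℂ) • x) →
      ∀ ν : ι → ℚ, LinearMap.trace ℂ _ (Θ₂ * y₀.baseChange ℂ) ≠
        ((LinearMap.trace ℚ V₂ (y₀ * y₀) : ℚ) : ℂ) * ∑ i, (ν i : ℂ) * LinearMap.trace ℂ _ (Θ₁ * (φ i).baseChange ℂ)) :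
    ι₂.toLinearMap ∘ₗ y₀ ∘ₗ π₂.toLinearMap ∈ H.hodgeLie ∧
      Module.finrank ℚ H.hodgeLie = Module.finrank ℚ H₁.hodgeLie + Module.finrank ℚ H₂.hodgeLie ∧
      ∀ 𝔞 : Submodule ℚ (Module.End ℚ V), 𝔞 ≤ H.hodgeLie →
        (∀ X ∈ 𝔞, ∀ Y ∈ 𝔞, X * Y - Y * X ∈ 𝔞) →
        (∃ Θ ∈ Submodule.span ℂ ((fun X : Module.End ℚ V => X.baseChange ℂ) '' (𝔞 : Set (Module.End ℚ V))),
          ∀ p, ∀ x ∈ H.piece p (n - p), Θ x = ((2 * p - n : ℤ) : ℂ) • x) → H.hodgeLie ≤ 𝔞 :=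
  corner_mem_and_finrank_eq_and_rigid_of_forall_not_graph ι₁ π₁ ι₂ π₂ hπι₁ hπι₂ hsum hrig₁ hy₀ fun _ hL =>
    not_exists_theta_mem_span_graph_of_trace_ne_sum ι₁ π₁ ι₂ π₂ hπι₁ hπι₂ hsum ψ₁ hφE hcen horth htr hNR hL

end Splitting

end HodgeStructure

end Literature.AlgebraicGeometry.Motives

end
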